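import Literature.RepresentationTheory.Semisimple.CharpolySubquotient
import Literature.RepresentationTheory.Semisimple.EquivOfCharacter
import Literature.RepresentationTheory.Semisimple.IsotypicProjection
import Mathlib
import HarnessLib

/-!
# Trace detection of irreducibility over an algebraically closed field

Stub `stub_traceDetect` (S2) of the line `slope-free-polarized-limit` for the crux
`Summit.Langlands.Langlands.Theses.PicardMuOrdinary.IrregularClassicality`.

Let `k` be an algebraically closed field (any characteristic), `R` a `k`-algebra, `N` a *simple*
`R`-module of finite dimension over `k` and `M` an arbitrary `R`-module of finite dimension over
`k` with `dim_k M = dim_k N` and `Tr_M(r) = Tr_N(r)` for every `r ∈ R`.  Then `M` is simple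
(`isSimpleModule_of_trace_smul_eq`).  For representations of a group `G` (`R = k[G]`): a
finite-dimensional representation with the dimension and the character of an irreducible one is
irreducible (`stub_traceDetect`).  In characteristic `p > 0` traces alone do not determine
semisimplifications (`p` copies of anything have character `0`), so the equality of dimensions
with a *simple* comparison module is what makes the statement true.

Proof (Bourbaki, *Algèbre* VIII, § 20 n° 6, Prop. 5 and Prop. 6, pp. 374–376; Curtis–Reiner
(27.8)).
* `exists_linearMap_ne_zero_of_trace_smul_eq`: if moreover `M` is semisimple then
  `Hom_R(N, M) ≠ 0`.  Otherwise the tree's density lemma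
  `Literature.RepresentationTheory.Semisimple.Module.exists_smul_isotypicProjection` (Jacobson
  density in `N × M`, Mathlib `Module.Finite.toModuleEnd_moduleEnd_surjective`) gives `r ∈ R`
  acting as the identity on `N` and as `0` on `M`, and Schur + density on `N`
  (`….Module.exists_trace_smul_eq_one`, `End_R(N) = k` as `k` is algebraically closed) gives
  `t ∈ R` with `Tr_N(t) = 1`; then `Tr_N(t r) = 1 ≠ 0 = Tr_M(t r)`.
* `isSimpleModule_of_trace_smul_eq_of_isSemisimpleModule`: a non-zero `R`-map out of the simple
  `N` is injective, hence bijective by dimensions, so `M ≃ N` is simple.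
* `isSimpleModule_of_trace_smul_eq`: for general `M`, a proper non-zero submodule `W₁ ⊆ M` gives
  semisimplifications `A` of `W₁` and `B` of `M / W₁` (tree
  `….Module.exists_isSemisimpleModule_charpoly_smul_eq`) with
  `χ_{A × B}(r) = χ_{W₁}(r) χ_{M/W₁}(r) = χ_M(r)` (`….Module.charpoly_smul_eq_mul_quotient`), so
  the semisimple `A × B` has the traces and the dimension of `N` and is simple by the previous
  step — absurd, `A × 0` being a proper non-zero submodule.
* `stub_traceDetect`: `R = k[G]`, `N = π.asModule`, `M = σ.asModule`; equal characters on `G`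
  give equal traces on `k[G]` by linearity
  (`….Representation.trace_asAlgebraHom_eq_of_character_eq`), and Mathlib's
  `Representation.irreducible_iff_isSimpleModule_asModule`.
-/

set_option linter.dupNamespace false -- project-wide option (lakefile weak.linter.dupNamespace); `Summit.Langlands.Langlands` is the mandated namespace
set_option autoImplicit false

noncomputable section

open Literature.RepresentationTheory.Semisimple
open Module

namespace Summit.Langlands.Langlands.Theorems.IrregularClassicality.SlopeFreePolarizedLimit

universe u v w w'

variable {k : Type u} [Field k] {R : Type v} [Ring R] [Algebra k R]
  {N : Type w} [AddCommGroup N] [Module k N] [Module R N] [IsScalarTower k R N]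
  [FiniteDimensional k N]
  {M : Type w'} [AddCommGroup M] [Module k M] [Module R M] [IsScalarTower k R M]
  [FiniteDimensional k M]

/-! ## (A) The semisimple case: density and Schur -/

/-- **Equal traces force a non-zero map out of the simple module.**  Let `k` be algebraically
closed, `R` a `k`-algebra, `N` a simple and `M` a semisimple `R`-module, both of finite
dimension over `k`, with `Tr_M(r) = Tr_N(r)` for all `r ∈ R`.  Then `Hom_R(N, M) ≠ 0`.
(If `Hom_R(N, M) = 0`, Jacobson density in `N × M` gives `r ∈ R` acting as `1` on `N` and `0`
on `M`, and Schur's lemma with density on `N` gives `t ∈ R` of trace `1` on `N`; then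
`Tr_N(t r) = 1` but `Tr_M(t r) = 0`.  Bourbaki, *Algèbre* VIII, § 20 n° 6, Prop. 5–6.) -/
theorem exists_linearMap_ne_zero_of_trace_smul_eq [IsAlgClosed k] [IsSimpleModule R N]
    [IsSemisimpleModule R M]
    (h : ∀ r : R, LinearMap.trace k M (DistribSMul.toLinearMap k M r) =
      LinearMap.trace k N (DistribSMul.toLinearMap k N r)) :
    ∃ f : N →ₗ[R] M, f ≠ 0 := by
  by_contra! hzero
  -- the simple submodule `⊤ ⊆ N` has `Hom_R(⊤, M) = 0`
  haveI : IsSimpleModule R (⊤ : Submodule R N) := IsSimpleModule.congr Submodule.topEquiv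
  have hSN : ∀ f : (⊤ : Submodule R N) →ₗ[R] M, f = 0 := fun f ↦
    LinearMap.ext fun x ↦ LinearMap.congr_fun
      (hzero (f ∘ₗ (Submodule.topEquiv (R := R) (M := N)).symm.toLinearMap)) (x : N)
  -- density in `N × M`: some `r ∈ R` is `1` on `N` and `0` on `M`
  obtain ⟨r, hM0, hNfix, -⟩ :=
    Module.exists_smul_isotypicProjection k (M := N) (N := M) (⊤ : Submodule R N) hSN
  -- Schur and density on `N`: some `t ∈ R` has trace `1` on `N`
  obtain ⟨t, ht⟩ := Module.exists_trace_smul_eq_one (k := k) (R := R) N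
  have hN : DistribSMul.toLinearMap k N (t * r) = DistribSMul.toLinearMap k N t := by
    apply LinearMap.ext
    intro x
    change (t * r) • x = t • x
    rw [mul_smul, hNfix x ((⊤ : Submodule R N).le_isotypicComponent Submodule.mem_top)]
  have hM : DistribSMul.toLinearMap k M (t * r) = 0 := by
    apply LinearMap.ext
    intro y
    change (t * r) • y = 0
    rw [mul_smul, hM0 y, smul_zero]
  have key := h (t * r)
  rw [hM, hN, map_zero, ht] at key
  exact zero_ne_one key

/-- **Trace detection, semisimple case.**  Let `k` be algebraically closed, `N` a simple and
`M` a semisimple `R`-module of the same finite dimension over `k`, with the same traces of all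
`r ∈ R`.  Then `M` is simple (indeed `M ≃ N`: a non-zero `R`-map `N → M` exists by
`exists_linearMap_ne_zero_of_trace_smul_eq`, is injective as `N` is simple, and bijective by
dimensions). -/
theorem isSimpleModule_of_trace_smul_eq_of_isSemisimpleModule [IsAlgClosed k]
    [IsSimpleModule R N] [IsSemisimpleModule R M]
    (hdim : finrank k M = finrank k N)
    (h : ∀ r : R, LinearMap.trace k M (DistribSMul.toLinearMap k M r) =
      LinearMap.trace k N (DistribSMul.toLinearMap k N r)) :
    IsSimpleModule R M := by
  obtain ⟨f, hf⟩ := exists_linearMap_ne_zero_of_trace_smul_eq (k := k) h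
  have hinj : Function.Injective f := (LinearMap.injective_or_eq_zero f).resolve_right hf
  have hsurj : Function.Surjective f :=
    (LinearMap.injective_iff_surjective_of_finrank_eq_finrank hdim.symm
      (f := f.restrictScalars k)).mp hinj
  exact IsSimpleModule.congr (LinearEquiv.ofBijective f ⟨hinj, hsurj⟩).symm

/-! ## (B) The general case: semisimplification of a submodule and its quotient -/

/-- **Trace detection of simplicity** (Bourbaki, *Algèbre* VIII, § 20 n° 6, Prop. 6;
Curtis–Reiner (27.8)).  Let `k` be an algebraically closed field, `R` a `k`-algebra, `N` a
simple `R`-module of finite dimension over `k`, and `M` an `R`-module of finite dimension over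
`k` with `dim_k M = dim_k N` and `Tr_M(r) = Tr_N(r)` for every `r ∈ R`.  Then `M` is simple.
(A proper non-zero submodule `W₁` would give a semisimple `W₁^{ss} × (M/W₁)^{ss}` with the
characteristic polynomials, hence traces and dimension, of `M`, simple by the semisimple case —
absurd.) -/
theorem isSimpleModule_of_trace_smul_eq [IsAlgClosed k] [IsSimpleModule R N]
    (hdim : finrank k M = finrank k N)
    (h : ∀ r : R, LinearMap.trace k M (DistribSMul.toLinearMap k M r) =
      LinearMap.trace k N (DistribSMul.toLinearMap k N r)) :
    IsSimpleModule R M := by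
  haveI : Nontrivial N := IsSimpleModule.nontrivial R N
  haveI : Nontrivial M :=
    Module.nontrivial_of_finrank_pos (R := k) (hdim ▸ Module.finrank_pos (R := k) (M := N))
  refine (isSimpleModule_iff R M).mpr { eq_bot_or_eq_top := fun W₁ ↦ ?_ }
  by_contra hW
  push Not at hW
  obtain ⟨hW0, hW1⟩ := hW
  haveI := Module.finiteDimensional_submodule_tower (k := k) W₁
  haveI : FiniteDimensional k (M ⧸ W₁) := Module.Finite.quotient k W₁
  haveI : Nontrivial W₁ := Submodule.nontrivial_iff_ne_bot.mpr hW0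
  haveI : Nontrivial (M ⧸ W₁) := Submodule.Quotient.nontrivial_iff.mpr hW1
  -- semisimplifications of `W₁` and `M / W₁`
  obtain ⟨A, _, _, _, _, _, _, hA⟩ :=
    Module.exists_isSemisimpleModule_charpoly_smul_eq (k := k) (R := R) W₁
  obtain ⟨B, _, _, _, _, _, _, hB⟩ :=
    Module.exists_isSemisimpleModule_charpoly_smul_eq (k := k) (R := R) (M ⧸ W₁)
  -- `A × B` is semisimple (Mathlib has the `Π`-instance only; the binary product is the
  -- tree's `Literature.AlgebraicGeometry.Motives.isSemisimpleModule_prod`, repeated inline as in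
  -- `Literature.RepresentationTheory.Semisimple.CharpolySubquotient` rather than imported)
  haveI : IsSemisimpleModule R (A × B) := by
    have h1 : IsSemisimpleModule R (LinearMap.range (LinearMap.inl R A B)) :=
      .of_surjective _ (LinearMap.inl R A B).surjective_rangeRestrict
    have h2 : IsSemisimpleModule R (LinearMap.range (LinearMap.inr R A B)) :=
      .of_surjective _ (LinearMap.inr R A B).surjective_rangeRestrict
    have h12 := IsSemisimpleModule.sup h1 h2
    rw [LinearMap.sup_range_inl_inr] at h12
    exact .congr (Submodule.topEquiv).symm
  -- `A × B` has the characteristic polynomials of `M`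
  have hchar : ∀ r : R, (DistribSMul.toLinearMap k (A × B) r).charpoly =
      (DistribSMul.toLinearMap k M r).charpoly := fun r ↦ by
    rw [Module.charpoly_smul_prod, hA r, hB r, ← Module.charpoly_smul_eq_mul_quotient (k := k) W₁ r]
  have htr : ∀ r : R, LinearMap.trace k (A × B) (DistribSMul.toLinearMap k (A × B) r) =
      LinearMap.trace k N (DistribSMul.toLinearMap k N r) := fun r ↦
    (LinearMap.trace_eq_of_charpoly_eq _ _ (hchar r)).trans (h r)
  have hdim' : finrank k (A × B) = finrank k N :=
    (LinearMap.finrank_eq_of_charpoly_eq _ _ (hchar 1)).trans hdim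
  haveI : IsSimpleModule R (A × B) :=
    isSimpleModule_of_trace_smul_eq_of_isSemisimpleModule (k := k) hdim' htr
  -- but `A ≠ 0 ≠ B`, so `A × 0` is a proper non-zero submodule
  haveI : Nontrivial A := Module.nontrivial_of_finrank_pos (R := k)
    ((LinearMap.finrank_eq_of_charpoly_eq _ _ (hA 1)).symm ▸ Module.finrank_pos (R := k) (M := W₁))
  haveI : Nontrivial B := Module.nontrivial_of_finrank_pos (R := k)
    ((LinearMap.finrank_eq_of_charpoly_eq _ _ (hB 1)).symm ▸
      Module.finrank_pos (R := k) (M := M ⧸ W₁))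
  rcases eq_bot_or_eq_top ((⊤ : Submodule R A).prod (⊥ : Submodule R B)) with h0 | h1
  · rw [Submodule.prod_eq_bot_iff] at h0
    exact top_ne_bot h0.1
  · rw [Submodule.prod_eq_top_iff] at h1
    exact bot_ne_top h1.2

/-! ## (C) The stub -/

/-- **Stub S2 — trace detection of irreducibility.**  Let `k` be an algebraically closed field
(of any characteristic), `G` a group, `π : G → GL(V)` an irreducible finite-dimensional
representation and `σ : G → GL(W)` a finite-dimensional representation with
`dim W = dim V` and `Tr σ(g) = Tr π(g)` for all `g ∈ G`.  Then `σ` is irreducible.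
(Module form `isSimpleModule_of_trace_smul_eq` for `R = k[G]`, `N = π.asModule`,
`M = σ.asModule`; the characters agree on `k[G]` by linearity.) -/
theorem stub_traceDetect :
    ∀ (k : Type) [Field k] [IsAlgClosed k] (G : Type) [Group G]
      (V : Type) [AddCommGroup V] [Module k V] [FiniteDimensional k V]
      (W : Type) [AddCommGroup W] [Module k W] [FiniteDimensional k W]
      (π : Representation k G V) (σ : Representation k G W),
      π.IsIrreducible → Module.finrank k W = Module.finrank k V →
      (∀ g : G, LinearMap.trace k W (σ g) = LinearMap.trace k V (π g)) → σ.IsIrreducible := by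
  intro k _ _ G _ V _ _ _ W _ _ _ π σ hπ hdim htr
  haveI := hπ
  rw [Representation.irreducible_iff_isSimpleModule_asModule]
  have hchar : σ.character = π.character := funext htr
  have h : ∀ r : MonoidAlgebra k G,
      LinearMap.trace k σ.asModule (DistribSMul.toLinearMap k σ.asModule r) =
        LinearMap.trace k π.asModule (DistribSMul.toLinearMap k π.asModule r) := fun r ↦
    Representation.trace_asAlgebraHom_eq_of_character_eq hchar r
  exact isSimpleModule_of_trace_smul_eq (k := k) (N := π.asModule) (M := σ.asModule) hdim h

end Summit.Langlands.Langlands.Theorems.IrregularClassicality.SlopeFreePolarizedLimit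

end
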